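import Summits.CriticalPhenomena.PercolationContinuityZ3.Theorems.PercNearOneGluingNoHeavyQuantFarTreeHubBlocks
import Summits.CriticalPhenomena.PercolationContinuityZ3.Theorems.PercNearOneGluingNoHeavyQuantHalfMeanSmallBall
import Summits.CriticalPhenomena.PercolationContinuityZ3.Theorems.PercNearOneGluingNoHeavyQuantTreeClusterTransfer
import HarnessLib

/-!
# QUANT lane R8, FAR on trees: the far-relay row for "hub with leaves + root blocks of a common gate" — all cells, and the
# route vocabulary

builds on p205010 (kernel theorem, internal audit signed; external expert review pending)

Support file (`--supports stmt-CriticalPhenomena-4575`), QUANT lane typer seat prim-quant-stmt (gen 11); completes `…QuantFarTreeHubBlocks.lean`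
(`Quant.farTree_hubBlocks_blockMin` / `_leafMin`, from the capped row `Quant.hubBlocks_smallBall`).  Theorems only; no definitions, no
sorries, standard axioms.

* `Quant.prodBernoulli_real_readFinset` — reading a finset of coordinates: events of `{i : ↥F | ↑i ∈ ω}` have the law of `prodBernoulli (q ∘ val)`
  (block principle, one block per coordinate; the weighted form of `Quant.prodBernoulli_real_leafCount`).
* `Quant.farTree_hubBlocks_heavy` — the cell "every block at least as reliable as the least leaf" (`q ℓ₀ ≤ q b`, NO common gate, NO regime):
  condition on the hub (`Quant.prodBernoulli_real_gate_split`) and apply the blob row `Quant.halfMean_smallBall` to blocks + leaves: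
  `P(count ≤ j) ≤ q h·(1 − q ℓ₀) + (1 − q h) = 1 − q h·q ℓ₀`.
* `Quant.farTree_hubBlocks_commonGate` — **FAR at EVERY layer for "hub (any gate) with leaf relays (any gates) + any number of root blocks
  (any sizes) of a COMMON gate `g₀ ≥ 1/2`"** (gate coordinates): `2j < Σ_{a∈A} P(a reached)` and the cuts `1 − q b ≤ t`, `1 − q h·q ℓ₀ ≤ t`
  give `P(#{a ∈ A counted} ≤ j) ≤ t`; the three cells `g₀ ≤ q h q ℓ₀` (blockMin), `q h q ℓ₀ < g₀ ≤ q ℓ₀` (leafMin), `q ℓ₀ < g₀` (heavy).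
* `Quant.farRelayRow_hubBlocks_commonGate` — the same in the ROUTE vocabulary: for every weight function on `Sym2 (Fin n)` supported on such a
  tree, the body of `Quant.FarRelayRow` for `A = L ∪ ⋃_b ({b} ∪ B b)` (one rewrite with `Quant.tree_relayCount_transfer`).
This extends `Quant.farRelayRow_hubBlock` (gen 10, ONE root block) to any number of equally reliable root blocks; for root blocks of different
gates only the capped row `Quant.farTree_hubBlocks` is in the kernel.  [cite: KozmaNitzan2024, Conjecture 3 (p. 15)] (the gluing rows served);
the family result is [this work].
-/

noncomputable section

namespace Summit.CriticalPhenomena.PercolationContinuityZ3.Theorems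

namespace Quant

open Finset MeasureTheory
open Literature.Probability.LatticeModels
open Literature.Probability.Percolation
open scoped Classical

variable {n : ℕ}

/-- **Reading a finset of coordinates** (block principle, one block per coordinate): for a nonempty finset `F` and any event `S` of the
read configuration `{i : ↥F | ↑i ∈ ω}`, `P_q({ω | {i | ↑i ∈ ω} ∈ S}) = P_{q ∘ val}(S)`. [folklore] -/
theorem prodBernoulli_real_readFinset (q : Fin n → unitInterval) (F : Finset (Fin n)) (hF : F.Nonempty)
    (S : Set (Set ↥F)) :
    (prodBernoulli q).real {ω : Set (Fin n) | {i : ↥F | (i : Fin n) ∈ ω} ∈ S} =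
      (prodBernoulli (fun i : ↥F => q i)).real S := by
  obtain ⟨x₁, hx₁⟩ := hF
  set blk : Fin n → ↥F := fun x => if hx : x ∈ F then ⟨x, hx⟩ else ⟨x₁, hx₁⟩ with hblk
  set g : ↥F → Set (Fin n) → Prop := fun i ω => (i : Fin n) ∈ ω with hg
  have hblkval : ∀ i : ↥F, blk i = i := by
    intro i
    simp only [hblk, dif_pos i.2]
  have hloc : IsBlockLocal blk g := by
    intro i ω ω' hagree
    exact hagree _ (hblkval i)
  have hmeas : ∀ i, Measurable (g i) := fun i => Measurable.of_discrete
  have hq : ∀ i : ↥F, (prodBernoulli q).real {ω | g i ω} = (fun i : ↥F => q i) i := by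
    intro i
    simp only [hg]
    exact prodBernoulli_real_setOf_mem q i
  have hread := prodBernoulli_real_preimage_readBlocks q blk hloc hmeas (fun i : ↥F => q i) hq
    (S := S) MeasurableSet.of_discrete
  rw [← hread]
  rfl

/-- **FAR for "hub with leaves + root blocks", the cell in which every block is at least as reliable as the least leaf** (`q ℓ₀ ≤ q b` on `K`;
no common gate, no regime).  Setting of `Quant.farTree_hubBlocks` with `ℓ₀ ∈ L` least reliable.  If `2j < q h·Σ_{ℓ∈L} q ℓ + Σ_{b∈K} q b·(|B b|+1)`
(the mean hypothesis) and `1 − q h·q ℓ₀ ≤ t` (the largest cut) then `P(#{a ∈ A counted} ≤ j) ≤ t`.  Proof: conditionally on the hub being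
open the count dominates the blob sum "blocks + leaves" (all gates `≥ q ℓ₀`, mean `> 2j`), to which `Quant.halfMean_smallBall` applies:
`P ≤ q h(1 − q ℓ₀) + (1 − q h)`. [this work] -/
theorem farTree_hubBlocks_heavy (q : Fin n → unitInterval) (o h ℓ₀ : Fin n) (L K : Finset (Fin n))
    (B : Fin n → Finset (Fin n)) (depth : Fin n → ℕ) (par : Fin n → Fin n) (j : ℕ) (t : ℝ)
    (hK : ∀ b ∈ K, par b = o ∧ depth b = 0)
    (hL : ∀ a ∈ L, par a = h ∧ depth a = 1) (hB : ∀ b ∈ K, ∀ a ∈ B b, par a = b ∧ depth a = 1)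
    (hhL : h ∉ L) (hhK : h ∉ K) (hLK : Disjoint L K) (hLB : ∀ b ∈ K, Disjoint L (B b))
    (hKB : ∀ b ∈ K, ∀ b' ∈ K, b ∉ B b') (hBB : ∀ b ∈ K, ∀ b' ∈ K, b ≠ b' → Disjoint (B b) (B b'))
    (hqB : ∀ b ∈ K, ∀ a ∈ B b, q a = 1) (hℓ₀ : ℓ₀ ∈ L) (hmin : ∀ a ∈ L, (q ℓ₀ : ℝ) ≤ q a)
    (hheavy : ∀ b ∈ K, (q ℓ₀ : ℝ) ≤ q b)
    (hEN : (2 * j : ℝ) < (q h : ℝ) * ∑ a ∈ L, (q a : ℝ) + ∑ b ∈ K, (q b : ℝ) * (((B b).card : ℝ) + 1))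
    (ht : 1 - (q h : ℝ) * q ℓ₀ ≤ t) :
    (prodBernoulli q).real {ω' : Set (Fin n) |
      ((L ∪ K.biUnion fun b => insert b (B b)).filter
        fun a => a = o ∨ ∀ i, i ≤ depth a → par^[i] a ∈ ω').card ≤ j} ≤ t := by
  set μ := prodBernoulli q with hμ
  have hmeas : ∀ S : Set (Set (Fin n)), MeasurableSet S := fun S => MeasurableSet.of_discrete
  have hG0 : (0 : ℝ) ≤ q h := (q h).2.1
  have hG1 : (q h : ℝ) ≤ 1 := (q h).2.2
  set s : Fin n → ℕ := fun b => (B b).card + 1 with hs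
  -- reduce to the block count and condition on the hub
  refine le_trans (farTree_hubBlocks_countReduce q o h L K B depth par j hK hL hB hLK hLB hKB hBB hqB) ?_
  set F : Set (Set (Fin n)) := {ω : Set (Fin n) |
    (∑ x ∈ K.filter (fun x => x ∈ ω), ((B x).card + 1)) + (if h ∈ ω then (L.filter fun x => x ∈ ω).card else 0) ≤ j} with hF
  set V : Set (Fin n) → ℕ := fun ω => (∑ x ∈ K.filter (fun x => x ∈ ω), s x) + (L.filter fun x => x ∈ ω).card with hV
  have hdet : DeterminedBy F (↑(Finset.univ : Finset (Fin n)) : Set (Fin n)) := by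
    rw [determinedBy_iff]
    intro ω ω' hω
    simp only [Finset.coe_univ, Set.inter_univ] at hω
    rw [hω]
  -- filters over `K` and `L` do not read the coordinate `h` (stated with a generic `ω'` so that the instances match)
  have hfilt : ∀ (S : Finset (Fin n)), h ∉ S → ∀ ω ω' : Set (Fin n), (∀ x, x ≠ h → (x ∈ ω' ↔ x ∈ ω)) →
      S.filter (fun x => x ∈ ω') = S.filter (fun x => x ∈ ω) := by
    intro S hS ω ω' hiff
    exact Finset.filter_congr fun x hx => hiff x fun hxh => hS (hxh ▸ hx)
  have hins : ∀ ω : Set (Fin n), ∀ x, x ≠ h → (x ∈ insert h ω ↔ x ∈ ω) := by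
    intro ω x hxh
    simp [Set.mem_insert_iff, hxh]
  have hopen : {ω : Set (Fin n) | insert h ω ∈ F} = {ω | V ω ≤ j} := by
    ext ω
    have hhω : h ∈ insert h ω := Set.mem_insert h ω
    simp only [hF, hV, hs, Set.mem_setOf_eq, hfilt K hhK ω (insert h ω) (hins ω), hfilt L hhL ω (insert h ω) (hins ω),
      if_pos hhω]
  have hsplit : μ.real F ≤ (q h : ℝ) * μ.real {ω | V ω ≤ j} + (1 - (q h : ℝ)) := by
    rw [hμ, prodBernoulli_real_gate_split q h F, prodBernoulli_real_update_one_eq hdet q (Finset.mem_univ h), hopen]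
    have h0 : (prodBernoulli (Function.update q h 0)).real F ≤ 1 := measureReal_le_one
    nlinarith [h0, hG0, hG1]
  -- the blob row for blocks + leaves, read on `F₀ = K ∪ L`
  set F₀ : Finset (Fin n) := K ∪ L with hF₀
  set a : Fin n → ℕ := fun x => if x ∈ K then s x else 1 with ha
  have hF₀ne : F₀.Nonempty := ⟨ℓ₀, Finset.mem_union_right _ hℓ₀⟩
  have hVsum : ∀ ω : Set (Fin n), V ω = ∑ x ∈ F₀.filter (fun x => x ∈ ω), a x := by
    intro ω
    show (∑ x ∈ K.filter (fun x => x ∈ ω), s x) + (L.filter fun x => x ∈ ω).card = _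
    rw [hF₀, Finset.filter_union, Finset.sum_union (Finset.disjoint_filter_filter hLK.symm)]
    congr 1
    · refine Finset.sum_congr rfl fun x hx => ?_
      rw [Finset.mem_filter] at hx
      simp only [ha, if_pos hx.1]
    · rw [Finset.card_eq_sum_ones]
      refine Finset.sum_congr rfl fun x hx => ?_
      rw [Finset.mem_filter] at hx
      have hxK : x ∉ K := fun hxK => Finset.disjoint_left.1 hLK hx.1 hxK
      simp only [ha, if_neg hxK]
  set S : Set (Set ↥F₀) := {σ : Set ↥F₀ | ∑ i ∈ univ.filter (fun i => i ∈ σ), a i ≤ j} with hS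
  have hevent : {ω : Set (Fin n) | V ω ≤ j} = {ω | {i : ↥F₀ | (i : Fin n) ∈ ω} ∈ S} := by
    ext ω
    simp only [Set.mem_setOf_eq, hVsum ω, hS]
    have hmap : ((univ.filter fun i : ↥F₀ => (i : Fin n) ∈ ω).map (Function.Embedding.subtype _)) =
        F₀.filter fun x => x ∈ ω := by
      ext x
      simp only [Finset.mem_map, Finset.mem_filter, Finset.mem_univ, true_and, Function.Embedding.coe_subtype]
      constructor
      · rintro ⟨i, hi, rfl⟩; exact ⟨i.2, hi⟩
      · rintro ⟨hxF, hxω⟩; exact ⟨⟨x, hxF⟩, hxω, rfl⟩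
    rw [← hmap, Finset.sum_map]
    simp only [Function.Embedding.coe_subtype]
  set p : ↥F₀ → unitInterval := fun i => q i with hp
  have hball : (prodBernoulli p).real S ≤ 1 - (q ℓ₀ : ℝ) := by
    refine halfMean_smallBall p (fun i => a i) j (1 - (q ℓ₀ : ℝ)) ?_ ?_
    · -- the mean: `Σ_{K} s_b q_b + Σ_{L} q_ℓ > 2j`
      have hsum : ∑ i : ↥F₀, ((a i : ℕ) : ℝ) * (p i : ℝ) = ∑ x ∈ F₀, (a x : ℝ) * (q x : ℝ) :=
        Finset.sum_coe_sort F₀ (fun x => (a x : ℝ) * (q x : ℝ))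
      rw [hsum, hF₀, Finset.sum_union hLK.symm]
      have hKs : ∑ x ∈ K, (a x : ℝ) * (q x : ℝ) = ∑ b ∈ K, (q b : ℝ) * (((B b).card : ℝ) + 1) := by
        refine Finset.sum_congr rfl fun x hx => ?_
        simp only [ha, if_pos hx, hs]; push_cast; ring
      have hLs : ∑ x ∈ L, (a x : ℝ) * (q x : ℝ) = ∑ x ∈ L, (q x : ℝ) := by
        refine Finset.sum_congr rfl fun x hx => ?_
        have hxK : x ∉ K := fun hxK => Finset.disjoint_left.1 hLK hx hxK
        simp only [ha, if_neg hxK]; push_cast; ring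
      rw [hKs, hLs]
      have hL0 : 0 ≤ ∑ x ∈ L, (q x : ℝ) := Finset.sum_nonneg fun x _ => (q x).2.1
      nlinarith
    · intro i
      rcases Finset.mem_union.1 i.2 with hiK | hiL
      · have := hheavy i hiK; rw [hp]; linarith
      · have := hmin i hiL; rw [hp]; linarith
  have hVle : μ.real {ω | V ω ≤ j} ≤ 1 - (q ℓ₀ : ℝ) := by
    rw [hevent, hμ, prodBernoulli_real_readFinset q F₀ hF₀ne S]; exact hball
  calc μ.real F ≤ (q h : ℝ) * μ.real {ω | V ω ≤ j} + (1 - (q h : ℝ)) := hsplit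
    _ ≤ (q h : ℝ) * (1 - (q ℓ₀ : ℝ)) + (1 - (q h : ℝ)) := by nlinarith [hVle, hG0]
    _ = 1 - (q h : ℝ) * q ℓ₀ := by ring
    _ ≤ t := ht

/-- **FAR at every layer for "hub with leaves + any number of root blocks of a common gate `g₀ ≥ 1/2`" (gate coordinates).**  Vertices
`Fin n` with independent gates `q`; observer `o`; hub `h` with leaf relays `L` (parent `h`, depth `1`, `ℓ₀ ∈ L` least reliable, arbitrary
gates); block vertices `b ∈ K` (parent `o`, depth `0`, all of gate `g₀ ≥ 1/2`) with block relays `B b` (parent `b`, depth `1`, gates `1`,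
any sizes); relays `A = L ∪ ⋃_b ({b} ∪ B b)`; any layer `j`.  If `2j < q h·Σ_{ℓ∈L} q ℓ + Σ_{b∈K} q b·(|B b|+1)` (the mean hypothesis
`2j < Σ_{a∈A} P(a reached)`) and `1 − q b ≤ t` (`b ∈ K`), `1 − q h·q ℓ₀ ≤ t` (the cut hypotheses at the candidates for the least likely
relay), then `P(#{a ∈ A counted} ≤ j) ≤ t`.  Cells: `Quant.farTree_hubBlocks_blockMin`, `…_leafMin`, `…_heavy`. [this work] -/
theorem farTree_hubBlocks_commonGate (q : Fin n → unitInterval) (o h ℓ₀ : Fin n) (L K : Finset (Fin n))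
    (B : Fin n → Finset (Fin n)) (depth : Fin n → ℕ) (par : Fin n → Fin n) (j : ℕ) (t g₀ : ℝ)
    (hK : ∀ b ∈ K, par b = o ∧ depth b = 0)
    (hL : ∀ a ∈ L, par a = h ∧ depth a = 1) (hB : ∀ b ∈ K, ∀ a ∈ B b, par a = b ∧ depth a = 1)
    (hhL : h ∉ L) (hhK : h ∉ K) (hLK : Disjoint L K) (hLB : ∀ b ∈ K, Disjoint L (B b))
    (hKB : ∀ b ∈ K, ∀ b' ∈ K, b ∉ B b') (hBB : ∀ b ∈ K, ∀ b' ∈ K, b ≠ b' → Disjoint (B b) (B b'))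
    (hqB : ∀ b ∈ K, ∀ a ∈ B b, q a = 1) (hℓ₀ : ℓ₀ ∈ L) (hmin : ∀ a ∈ L, (q ℓ₀ : ℝ) ≤ q a)
    (hg : ∀ b ∈ K, (q b : ℝ) = g₀) (hhalf : (1 / 2 : ℝ) ≤ g₀)
    (hEN : (2 * j : ℝ) < (q h : ℝ) * ∑ a ∈ L, (q a : ℝ) + ∑ b ∈ K, (q b : ℝ) * (((B b).card : ℝ) + 1))
    (htK : ∀ b ∈ K, 1 - (q b : ℝ) ≤ t) (htℓ : 1 - (q h : ℝ) * q ℓ₀ ≤ t) :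
    (prodBernoulli q).real {ω' : Set (Fin n) |
      ((L ∪ K.biUnion fun b => insert b (B b)).filter
        fun a => a = o ∨ ∀ i, i ≤ depth a → par^[i] a ∈ ω').card ≤ j} ≤ t := by
  -- the mean with the common gate pulled out
  have hEN' : (2 * j : ℝ) < (q h : ℝ) * ∑ a ∈ L, (q a : ℝ) + g₀ * ∑ b ∈ K, (((B b).card : ℝ) + 1) := by
    have : ∑ b ∈ K, (q b : ℝ) * (((B b).card : ℝ) + 1) = g₀ * ∑ b ∈ K, (((B b).card : ℝ) + 1) := by
      rw [Finset.mul_sum]; exact Finset.sum_congr rfl fun b hb => by rw [hg b hb]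
    rw [← this]; exact hEN
  rcases K.eq_empty_or_nonempty with hKe | ⟨b₀, hb₀⟩
  · -- no blocks: the heavy cell applies vacuously
    exact farTree_hubBlocks_heavy q o h ℓ₀ L K B depth par j t hK hL hB hhL hhK hLK hLB hKB hBB hqB hℓ₀ hmin
      (fun b hb => by rw [hKe] at hb; exact absurd hb (Finset.notMem_empty b)) hEN htℓ
  by_cases hcell1 : g₀ ≤ (q h : ℝ) * q ℓ₀
  · have htb : 1 - g₀ ≤ t := by rw [← hg b₀ hb₀]; exact htK b₀ hb₀
    exact farTree_hubBlocks_blockMin q o h ℓ₀ L K B depth par j t g₀ hK hL hB hhL hhK hLK hLB hKB hBB hqB hmin hg hhalf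
      hcell1 hEN' htb
  push Not at hcell1
  by_cases hcell2 : g₀ ≤ (q ℓ₀ : ℝ)
  · exact farTree_hubBlocks_leafMin q o h ℓ₀ L K B depth par j t g₀ hK hL hB hhL hhK hLK hLB hKB hBB hqB hmin hg hhalf
      hcell1.le hcell2 hEN' htℓ
  · push Not at hcell2
    exact farTree_hubBlocks_heavy q o h ℓ₀ L K B depth par j t hK hL hB hhL hhK hLK hLB hKB hBB hqB hℓ₀ hmin
      (fun b hb => by rw [hg b hb]; exact hcell2.le) hEN htℓ

/-- **FAR for "hub + root blocks of a common gate" in the ROUTE vocabulary (bond percolation with tree-supported weights on `Sym2 (Fin n)`).**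
Weights `w` supported on a rooted tree with coordinates `par`/`depth` (as in `Quant.tree_relayCount_transfer`) in which the hub `h` and the block
vertices `b ∈ K` are children of the observer `o` (depth `0`), the leaf relays `L` are children of `h` and the block relays `B b` are children of
`b` glued by weight `1` (depth `1`); all edges `o–b`, `b ∈ K`, carry the same weight `g₀ ≥ 1/2`.  Then the body of `Quant.FarRelayRow` holds for
`A = L ∪ ⋃_b ({b} ∪ B b)` at every layer `j`: `2j < Σ_{a∈A} P_w(o ↔ a)` and `P_w(o ↮ a) ≤ t` on `A` imply
`P_w(#{a ∈ A | o ↔ a} ≤ j) ≤ t`.  One rewrite with `tree_relayCount_transfer`, marginals by `tree_real_openConn_eq_prod`, then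
`farTree_hubBlocks_commonGate`. [this work] -/
theorem farRelayRow_hubBlocks_commonGate (w : Sym2 (Fin n) → unitInterval) (o h ℓ₀ : Fin n) (L K : Finset (Fin n))
    (B : Fin n → Finset (Fin n)) (depth : Fin n → ℕ) (par : Fin n → Fin n) (j : ℕ) (t g₀ : ℝ)
    (hroot : ∀ x, x ≠ o → depth x = 0 → par x = o)
    (hstep : ∀ x, x ≠ o → depth x ≠ 0 → par x ≠ o ∧ depth (par x) + 1 = depth x)
    (hsupp : ∀ e, w e ≠ 0 → e.IsDiag ∨ ∃ x, x ≠ o ∧ e = s(par x, x))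
    (hho : h ≠ o) (hoK : o ∉ K) (hoL : o ∉ L) (hoB : ∀ b ∈ K, o ∉ B b) (hh : depth h = 0)
    (hK : ∀ b ∈ K, par b = o ∧ depth b = 0)
    (hL : ∀ a ∈ L, par a = h ∧ depth a = 1) (hB : ∀ b ∈ K, ∀ a ∈ B b, par a = b ∧ depth a = 1)
    (hhL : h ∉ L) (hhK : h ∉ K) (hLK : Disjoint L K) (hLB : ∀ b ∈ K, Disjoint L (B b))
    (hKB : ∀ b ∈ K, ∀ b' ∈ K, b ∉ B b') (hBB : ∀ b ∈ K, ∀ b' ∈ K, b ≠ b' → Disjoint (B b) (B b'))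
    (hℓ₀ : ℓ₀ ∈ L) (hmin : ∀ a ∈ L, (w s(h, ℓ₀) : ℝ) ≤ w s(h, a)) (hwB : ∀ b ∈ K, ∀ a ∈ B b, (w s(b, a) : ℝ) = 1)
    (hg : ∀ b ∈ K, (w s(o, b) : ℝ) = g₀) (hhalf : (1 / 2 : ℝ) ≤ g₀)
    (hEN : (2 * j : ℝ) < ∑ a ∈ L ∪ K.biUnion (fun b => insert b (B b)), (prodBernoulli w).real (openConn o a))
    (ht : ∀ a ∈ L ∪ K.biUnion (fun b => insert b (B b)),
      (prodBernoulli w).real (openConn o a : Set (BondConfig (Fin n)))ᶜ ≤ t) :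
    (prodBernoulli w).real {ω : BondConfig (Fin n) |
      ((L ∪ K.biUnion fun b => insert b (B b)).filter fun a => ω ∈ openConn o a).card ≤ j} ≤ t := by
  rw [tree_relayCount_transfer n w o depth par hroot hstep hsupp (L ∪ K.biUnion fun b => insert b (B b)) j]
  set q : Fin n → unitInterval := fun x => if x = o then 1 else w s(par x, x) with hq
  have hmeasW : ∀ S : Set (BondConfig (Fin n)), MeasurableSet S := fun S => (Set.toFinite S).measurableSet
  have hph : par h = o := hroot h hho hh
  have hqh : q h = w s(o, h) := by simp only [hq, if_neg hho, hph]
  have hbo : ∀ b ∈ K, b ≠ o := fun b hb hbo => hoK (hbo ▸ hb)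
  have hqb : ∀ b ∈ K, q b = w s(o, b) := by
    intro b hb
    simp only [hq, if_neg (hbo b hb), (hK b hb).1]
  have hqL : ∀ a ∈ L, q a = w s(h, a) := by
    intro a ha
    have hao : a ≠ o := fun hao => hoL (hao ▸ ha)
    simp only [hq, if_neg hao, (hL a ha).1]
  have hqB : ∀ b ∈ K, ∀ a ∈ B b, q a = 1 := by
    intro b hb a ha
    have hao : a ≠ o := fun hao => hoB b hb (hao ▸ ha)
    have h1 : (q a : ℝ) = 1 := by
      simp only [hq, if_neg hao, (hB b hb a ha).1]
      exact hwB b hb a ha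
    exact Subtype.ext (by exact_mod_cast h1)
  -- marginals
  have hmL : ∀ a ∈ L, (prodBernoulli w).real (openConn o a) = (q h : ℝ) * q a := by
    intro a ha
    have hao : a ≠ o := fun hao => hoL (hao ▸ ha)
    rw [tree_real_openConn_eq_prod n w o depth par hroot hstep hsupp a hao, (hL a ha).2,
      Finset.prod_range_succ, Finset.prod_range_one, Function.iterate_zero_apply, Function.iterate_one,
      (hL a ha).1, hph, hqh, hqL a ha, mul_comm]
  have hmb : ∀ b ∈ K, (prodBernoulli w).real (openConn o b) = q b := by
    intro b hb
    rw [tree_real_openConn_eq_prod n w o depth par hroot hstep hsupp b (hbo b hb), (hK b hb).2, Finset.prod_range_one,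
      Function.iterate_zero_apply, (hK b hb).1, hqb b hb]
  have hmB : ∀ b ∈ K, ∀ a ∈ B b, (prodBernoulli w).real (openConn o a) = q b := by
    intro b hb a ha
    have hao : a ≠ o := fun hao => hoB b hb (hao ▸ ha)
    rw [tree_real_openConn_eq_prod n w o depth par hroot hstep hsupp a hao, (hB b hb a ha).2,
      Finset.prod_range_succ, Finset.prod_range_one, Function.iterate_zero_apply, Function.iterate_one,
      (hB b hb a ha).1, (hK b hb).1, hqb b hb, hwB b hb a ha, one_mul]
  -- the relay set as a disjoint union
  have hdisjLK' : Disjoint L (K.biUnion fun b => insert b (B b)) := by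
    rw [Finset.disjoint_biUnion_right]
    intro b hb
    rw [Finset.disjoint_insert_right]
    exact ⟨fun hbL => Finset.disjoint_left.1 hLK hbL hb, hLB b hb⟩
  have hpair : ∀ b ∈ K, ∀ b' ∈ K, b ≠ b' → Disjoint (insert b (B b)) (insert b' (B b')) := by
    intro b hb b' hb' hbb'
    rw [Finset.disjoint_left]
    intro a ha ha'
    rcases Finset.mem_insert.1 ha with rfl | haB
    · rcases Finset.mem_insert.1 ha' with hab' | haB'
      · exact hbb' hab'
      · exact hKB a hb b' hb' haB'
    · rcases Finset.mem_insert.1 ha' with rfl | haB'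
      · exact hKB a hb' b hb haB
      · exact Finset.disjoint_left.1 (hBB b hb b' hb' hbb') haB haB'
  -- the mean hypothesis in gate form
  have hEN' : (2 * j : ℝ) < (q h : ℝ) * ∑ a ∈ L, (q a : ℝ) + ∑ b ∈ K, (q b : ℝ) * (((B b).card : ℝ) + 1) := by
    rw [Finset.sum_union hdisjLK', Finset.sum_biUnion (fun b hb b' hb' hbb' => hpair b hb b' hb' hbb'),
      Finset.sum_congr rfl hmL, ← Finset.mul_sum] at hEN
    have hblocks : ∑ b ∈ K, ∑ a ∈ insert b (B b), (prodBernoulli w).real (openConn o a) =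
        ∑ b ∈ K, (q b : ℝ) * (((B b).card : ℝ) + 1) := by
      refine Finset.sum_congr rfl fun b hb => ?_
      rw [Finset.sum_insert (hKB b hb b hb), hmb b hb, Finset.sum_congr rfl (hmB b hb), Finset.sum_const, nsmul_eq_mul]
      ring
    rw [hblocks] at hEN
    exact hEN
  -- cuts
  have htK : ∀ b ∈ K, 1 - (q b : ℝ) ≤ t := by
    intro b hb
    have := ht b (Finset.mem_union_right _ (Finset.mem_biUnion.2 ⟨b, hb, Finset.mem_insert_self _ _⟩))
    rw [probReal_compl_eq_one_sub (hmeasW _), hmb b hb] at this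
    exact this
  have htℓ : 1 - (q h : ℝ) * (q ℓ₀ : ℝ) ≤ t := by
    have := ht ℓ₀ (Finset.mem_union_left _ hℓ₀)
    rw [probReal_compl_eq_one_sub (hmeasW _), hmL ℓ₀ hℓ₀] at this
    exact this
  have hmin' : ∀ a ∈ L, (q ℓ₀ : ℝ) ≤ q a := by
    intro a ha
    rw [hqL ℓ₀ hℓ₀, hqL a ha]
    exact hmin a ha
  have hg' : ∀ b ∈ K, (q b : ℝ) = g₀ := fun b hb => by rw [hqb b hb]; exact hg b hb
  exact farTree_hubBlocks_commonGate q o h ℓ₀ L K B depth par j t g₀ hK hL hB hhL hhK hLK hLB hKB hBB hqB hℓ₀ hmin' hg' hhalf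
    hEN' htK htℓ


/-- **The `o ∈ A` cell** of `Quant.farRelayRow_hubBlocks_commonGate`: the same family with the observer itself counted as a relay
(`A = {o} ∪ L ∪ ⋃_b ({b} ∪ B b)`; `P(o ↔ o) = 1`), i.e. the body of `Quant.FarRelayRow` also when `o ∈ A` — one sure relay shifts the layer
by one (`2j < 1 + Σ ⟹ 2(j−1) < Σ`). [this work] -/
theorem farRelayRow_hubBlocks_commonGate_root (w : Sym2 (Fin n) → unitInterval) (o h ℓ₀ : Fin n) (L K : Finset (Fin n))
    (B : Fin n → Finset (Fin n)) (depth : Fin n → ℕ) (par : Fin n → Fin n) (j : ℕ) (t g₀ : ℝ)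
    (hroot : ∀ x, x ≠ o → depth x = 0 → par x = o)
    (hstep : ∀ x, x ≠ o → depth x ≠ 0 → par x ≠ o ∧ depth (par x) + 1 = depth x)
    (hsupp : ∀ e, w e ≠ 0 → e.IsDiag ∨ ∃ x, x ≠ o ∧ e = s(par x, x))
    (hho : h ≠ o) (hoK : o ∉ K) (hoL : o ∉ L) (hoB : ∀ b ∈ K, o ∉ B b) (hh : depth h = 0)
    (hK : ∀ b ∈ K, par b = o ∧ depth b = 0)
    (hL : ∀ a ∈ L, par a = h ∧ depth a = 1) (hB : ∀ b ∈ K, ∀ a ∈ B b, par a = b ∧ depth a = 1)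
    (hhL : h ∉ L) (hhK : h ∉ K) (hLK : Disjoint L K) (hLB : ∀ b ∈ K, Disjoint L (B b))
    (hKB : ∀ b ∈ K, ∀ b' ∈ K, b ∉ B b') (hBB : ∀ b ∈ K, ∀ b' ∈ K, b ≠ b' → Disjoint (B b) (B b'))
    (hℓ₀ : ℓ₀ ∈ L) (hmin : ∀ a ∈ L, (w s(h, ℓ₀) : ℝ) ≤ w s(h, a)) (hwB : ∀ b ∈ K, ∀ a ∈ B b, (w s(b, a) : ℝ) = 1)
    (hg : ∀ b ∈ K, (w s(o, b) : ℝ) = g₀) (hhalf : (1 / 2 : ℝ) ≤ g₀)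
    (hEN : (2 * j : ℝ) <
      ∑ a ∈ insert o (L ∪ K.biUnion (fun b => insert b (B b))), (prodBernoulli w).real (openConn o a))
    (ht : ∀ a ∈ insert o (L ∪ K.biUnion (fun b => insert b (B b))),
      (prodBernoulli w).real (openConn o a : Set (BondConfig (Fin n)))ᶜ ≤ t) :
    (prodBernoulli w).real {ω : BondConfig (Fin n) |
      ((insert o (L ∪ K.biUnion fun b => insert b (B b))).filter fun a => ω ∈ openConn o a).card ≤ j} ≤ t := by
  set A : Finset (Fin n) := L ∪ K.biUnion fun b => insert b (B b) with hA
  have hmeasW : ∀ S : Set (BondConfig (Fin n)), MeasurableSet S := fun S => (Set.toFinite S).measurableSet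
  have hoA : o ∉ A := by
    rw [hA, Finset.mem_union, not_or]
    refine ⟨hoL, fun hob => ?_⟩
    rw [Finset.mem_biUnion] at hob
    obtain ⟨b, hb, hob⟩ := hob
    rcases Finset.mem_insert.1 hob with hobeq | hoBb
    · exact hoK (hobeq ▸ hb)
    · exact hoB b hb hoBb
  have hoo : ∀ ω : BondConfig (Fin n), ω ∈ (openConn o o : Set (BondConfig (Fin n))) :=
    fun ω => (SimpleGraph.Reachable.refl o : (openGraph ω).Reachable o o)
  -- the observer is a sure relay: the count is `1 + #(A-count)`
  have hcount : ∀ ω : BondConfig (Fin n),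
      ((insert o A).filter fun a => ω ∈ openConn o a).card = (A.filter fun a => ω ∈ openConn o a).card + 1 := by
    intro ω
    rw [Finset.filter_insert, if_pos (hoo ω), Finset.card_insert_of_notMem]
    exact fun ho => hoA (Finset.mem_filter.1 ho).1
  have ht' : ∀ a ∈ A, (prodBernoulli w).real (openConn o a : Set (BondConfig (Fin n)))ᶜ ≤ t :=
    fun a ha => ht a (Finset.mem_insert_of_mem ha)
  have ht0 : 0 ≤ t := by
    have := ht o (Finset.mem_insert_self _ _)
    exact le_trans measureReal_nonneg this
  rcases Nat.eq_zero_or_pos j with hj | hj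
  · -- `j = 0`: the event is empty
    subst hj
    have hempty : {ω : BondConfig (Fin n) | ((insert o A).filter fun a => ω ∈ openConn o a).card ≤ 0} = ∅ := by
      ext ω
      simp only [Set.mem_setOf_eq, Set.mem_empty_iff_false, iff_false, not_le, hcount ω]
      omega
    rw [hempty, measureReal_empty]
    exact ht0
  · -- `j ≥ 1`: shift the layer
    have hEN' : (2 * ((j - 1 : ℕ) : ℝ)) < ∑ a ∈ A, (prodBernoulli w).real (openConn o a) := by
      rw [Finset.sum_insert hoA] at hEN
      have h1 : (prodBernoulli w).real (openConn o o : Set (BondConfig (Fin n))) ≤ 1 := measureReal_le_one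
      push_cast [Nat.cast_sub hj]
      linarith
    have hev : {ω : BondConfig (Fin n) | ((insert o A).filter fun a => ω ∈ openConn o a).card ≤ j} =
        {ω : BondConfig (Fin n) | (A.filter fun a => ω ∈ openConn o a).card ≤ j - 1} := by
      ext ω
      simp only [Set.mem_setOf_eq, hcount ω]
      omega
    rw [hev]
    exact farRelayRow_hubBlocks_commonGate w o h ℓ₀ L K B depth par (j - 1) t g₀ hroot hstep hsupp hho hoK hoL hoB hh hK hL hB
      hhL hhK hLK hLB hKB hBB hℓ₀ hmin hwB hg hhalf hEN' ht'

end Quant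

end Summit.CriticalPhenomena.PercolationContinuityZ3.Theorems

end
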